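import Literature.NumberTheory.EllipticCurves.CofreeContinuousRepNewform
import Literature.NumberTheory.EllipticCurves.PadicCoeffIntegersFrobeniusData
import Mathlib.NumberTheory.Padics.RingHoms
import HarnessLib

/-!
# The cofree module `A = Kⁿ/𝒪ⁿ = T ⊗ K/𝒪` is `p`-primary with finite `p`-torsion
# (`A[p] ≃ (𝒪/p)ⁿ`; Greenberg 1989 p. 98: "`A_p = V_p/T_p`, which as a group is just `(ℚ_p/ℤ_p)^d`")

Cell `bsd-stepL`, typer lane, for the members `A_{g_m} = Cofree Δ.ρ K` of the Road FF: the two scalar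
hypotheses `hprim` ("every element is killed by a power of `p`") and `hfin` ("`{a | p • a = 0}` is finite")
of [SU14, Lemma 3.1.9] in the tree's typed forms `SkinnerUrban2014.lemma319_finite_XBig` /
`SkinnerUrban2014.moduleFinite_XBig_of_lemma319`, discharged for the tree's cofree module
`GreenbergSelmer.Cofree ρ F = (Fin n → F) ⧸ 𝒪ⁿ` (file `GreenbergSelmerNewform.lean`).

* §1 For any `𝒪 → F` and a natural number `m` invertible in `F` with `𝒪/m𝒪` finite:
  `Cofree.finite_setOf_nsmul_eq_zero` — `A[m]` is finite (it is the image of `𝒪ⁿ/m𝒪ⁿ` under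
  `y ↦ m⁻¹y mod 𝒪ⁿ`); `Cofree.exists_pow_nsmul_eq_zero` — `A` is `q`-primary as soon as every `x ∈ F`
  has `q^j x ∈ 𝒪` for some `j`.
* §2 `finite_quotient_span_algebraMap` — `𝒪/r𝒪` is finite for an `R`-algebra `𝒪` finite as an
  `R`-module when `R/rR` is finite; `finite_padicInt_quotient_p` — `ℤ_p/p ≃ 𝔽_p` is finite.
* §3 The `p`-adic coefficient pair `(𝒪, K) = (padicCoeffIntegers ι, padicCoeffField ι)` of a newform
  (`K/ℚ_p` finite): `finite_padicCoeffIntegers_quotient_p`, and for every framed `ρ : G → GL_n(𝒪)`: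
  **`Cofree.finite_setOf_psmul_eq_zero`** (`A[p]` finite) and **`Cofree.exists_pow_psmul_eq_zero`**
  (`A` is `p`-primary).

Theorems only; no named fact, no `sorry`, no instance.

References: [Greenberg1989] §1 p. 98 ("`A_p = V_p/T_p` which as a group is just `(ℚ_p/ℤ_p)^d`");
[EmertonPollackWeston2006] §3.1 (p. 17: "`A_f` … a cofree `𝒪`-module of corank 2", "`𝒪` the ring of
integers of `K`"); [SkinnerUrban2014] Lemma 3.1.9 (the hypotheses served).
-/

noncomputable section

open Literature.NumberTheory.GaloisRepresentations Literature.NumberTheory.Automorphic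

namespace Literature.NumberTheory.EllipticCurves.GreenbergSelmer

/-- A map that factors through a surjection onto a finite type has finite range. [folklore] -/
private theorem finite_range_of_factors {X Q Y : Type*} [Finite Q] (π : X → Q)
    (hπ : Function.Surjective π) (ψ : X → Y) (h : ∀ x x', π x = π x' → ψ x = ψ x') :
    (Set.range ψ).Finite := by
  refine (Set.finite_range (ψ ∘ Function.surjInv hπ)).subset ?_
  rintro _ ⟨x, rfl⟩
  exact ⟨π x, h _ _ (Function.surjInv_eq hπ (π x))⟩

/-! ### §1. `A[m]` is finite and `A` is primary, for a general coefficient pair `𝒪 → F` -/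

section General

variable {G : Type*} [Group G] [TopologicalSpace G] {n : ℕ} {𝒪 : Type*} [CommRing 𝒪]
  [TopologicalSpace 𝒪] {F : Type*} [Field F] [Algebra 𝒪 F] (ρ : FramedRep G 𝒪 n)

/-- **`A[m]` is finite** for `A = Fⁿ/𝒪ⁿ`, `m` invertible in `F` and `𝒪/m𝒪` finite: a class `x mod 𝒪ⁿ`
with `m x ∈ 𝒪ⁿ`, say `m x = y`, is `m⁻¹ y mod 𝒪ⁿ`, which depends only on `y mod m𝒪ⁿ`
("`A_p … as a group is just `(ℚ_p/ℤ_p)^d`", so `A_p[m] ≃ (ℤ/m)^d`). [cite: Greenberg1989, §1 p. 98] -/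
theorem Cofree.finite_setOf_nsmul_eq_zero (m : ℕ) (hm : (m : F) ≠ 0)
    [Finite (𝒪 ⧸ Ideal.span {(m : 𝒪)})] : {a : Cofree ρ F | m • a = 0}.Finite := by
  classical
  let ψ : (Fin n → 𝒪) → Cofree ρ F := fun y ↦
    cofreeMk F ρ (fun i ↦ (m : F)⁻¹ * algebraMap 𝒪 F (y i))
  let π : (Fin n → 𝒪) → (Fin n → 𝒪 ⧸ Ideal.span {(m : 𝒪)}) := fun y i ↦ Ideal.Quotient.mk _ (y i)
  have hπ : Function.Surjective π := fun q ↦ by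
    choose y hy using fun i ↦ Ideal.Quotient.mk_surjective (q i)
    exact ⟨y, funext hy⟩
  have hψ : ∀ y y', π y = π y' → ψ y = ψ y' := by
    intro y y' hyy'
    have hd : ∀ i, ∃ c : 𝒪, c * (m : 𝒪) = y i - y' i := fun i ↦
      Ideal.mem_span_singleton'.1 (Ideal.Quotient.eq.1 (congrFun hyy' i))
    choose c hc using hd
    rw [← sub_eq_zero]
    change cofreeMk F ρ _ - cofreeMk F ρ _ = 0
    rw [← map_sub, ← LinearMap.mem_ker, ker_cofreeMk, mem_lattice_iff]
    refine ⟨c, funext fun i ↦ ?_⟩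
    rw [Pi.sub_apply, ← mul_sub, ← map_sub, ← hc i, map_mul, map_natCast, mul_comm (algebraMap 𝒪 F (c i)),
      inv_mul_cancel_left₀ hm]
  refine (finite_range_of_factors π hπ ψ hψ).subset ?_
  rintro a (ha : m • a = 0)
  obtain ⟨x, rfl⟩ := cofreeMk_surjective F ρ a
  have hx : m • x ∈ lattice n 𝒪 F := by
    rw [← ker_cofreeMk (F := F) ρ, LinearMap.mem_ker, map_nsmul, ha]
  obtain ⟨y, hy⟩ := (mem_lattice_iff _).1 hx
  refine ⟨y, ?_⟩
  change cofreeMk F ρ _ = cofreeMk F ρ x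
  congr 1
  funext i
  rw [congrFun hy i, Pi.smul_apply, nsmul_eq_mul, inv_mul_cancel_left₀ hm]

/-- **`A = Fⁿ/𝒪ⁿ` is `q`-primary** when every `x ∈ F` has `q^j x ∈ 𝒪` for some `j` (e.g. `F = 𝒪[1/q]`):
`q^J (x mod 𝒪ⁿ) = 0` for `J` the largest exponent needed by the coordinates of `x`.
[cite: Greenberg1989, §1 p. 98 ("`A_p = V_p/T_p` … `(ℚ_p/ℤ_p)^d`")] -/
theorem Cofree.exists_pow_nsmul_eq_zero (q : ℕ)
    (hden : ∀ x : F, ∃ (j : ℕ) (y : 𝒪), algebraMap 𝒪 F y = (q : F) ^ j * x) (a : Cofree ρ F) :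
    ∃ j : ℕ, q ^ j • a = 0 := by
  classical
  obtain ⟨x, rfl⟩ := cofreeMk_surjective F ρ a
  choose j y hy using fun i ↦ hden (x i)
  refine ⟨Finset.univ.sup j, ?_⟩
  rw [← map_nsmul, ← LinearMap.mem_ker, ker_cofreeMk, mem_lattice_iff]
  refine ⟨fun i ↦ (q : 𝒪) ^ (Finset.univ.sup j - j i) * y i, funext fun i ↦ ?_⟩
  rw [map_mul, map_pow, map_natCast, hy i, ← mul_assoc, ← pow_add,
    Nat.sub_add_cancel (Finset.le_sup (f := j) (Finset.mem_univ i)), Pi.smul_apply, nsmul_eq_mul,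
    Nat.cast_pow]

end General

/-! ### §2. Finiteness of `𝒪/r𝒪` -/

section Quotient

/-- **`𝒪/r𝒪` is finite** for an `R`-algebra `𝒪` that is finitely generated as an `R`-module, when
`R/rR` is finite: `𝒪/r𝒪` is the image of `(R/r)^s` for a finite generating set `s`. [folklore: Atiyah–Macdonald Prop. 2.17 style base change of finite generation] -/
private theorem finite_quotient_span_algebraMap {R 𝒪 : Type*} [CommRing R] [CommRing 𝒪] [Algebra R 𝒪]
    [Module.Finite R 𝒪] (r : R) [Finite (R ⧸ Ideal.span {r})] :
    Finite (𝒪 ⧸ Ideal.span {algebraMap R 𝒪 r}) := by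
  classical
  obtain ⟨s, hs⟩ := Module.Finite.fg_top (R := R) (M := 𝒪)
  let ψ : (s → R) → 𝒪 ⧸ Ideal.span {algebraMap R 𝒪 r} := fun c ↦
    Ideal.Quotient.mk _ (∑ i, c i • (i : 𝒪))
  let π : (s → R) → (s → R ⧸ Ideal.span {r}) := fun c i ↦ Ideal.Quotient.mk _ (c i)
  have hπ : Function.Surjective π := fun q ↦ by
    choose c hc using fun i ↦ Ideal.Quotient.mk_surjective (q i)
    exact ⟨c, funext hc⟩
  have hψ : ∀ c c', π c = π c' → ψ c = ψ c' := by
    intro c c' hcc'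
    have hd : ∀ i, ∃ d : R, d * r = c i - c' i := fun i ↦
      Ideal.mem_span_singleton'.1 (Ideal.Quotient.eq.1 (congrFun hcc' i))
    choose d hd using hd
    refine Ideal.Quotient.eq.2 (Ideal.mem_span_singleton'.2 ⟨∑ i, d i • (i : 𝒪), ?_⟩)
    rw [← Finset.sum_sub_distrib, Finset.sum_mul]
    refine Finset.sum_congr rfl fun i _ ↦ ?_
    rw [← sub_smul, ← hd i, mul_comm (d i) r, mul_smul, Algebra.smul_def r, smul_mul_assoc, mul_comm]
    exact (mul_smul_comm _ _ _).symm
  have hsurj : Set.range ψ = Set.univ := by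
    refine Set.eq_univ_of_forall fun z ↦ ?_
    obtain ⟨o, rfl⟩ := Ideal.Quotient.mk_surjective z
    have ho : o ∈ Submodule.span R (Set.range (Subtype.val : s → 𝒪)) := by
      rw [Subtype.range_coe_subtype, Finset.setOf_mem, hs]; trivial
    obtain ⟨c, hc⟩ := (Submodule.mem_span_range_iff_exists_fun R).1 ho
    exact ⟨c, by simp only [ψ, hc]⟩
  have hfin := finite_range_of_factors π hπ ψ hψ
  rw [hsurj] at hfin
  exact Set.finite_univ_iff.1 hfin

/-- **`ℤ_p/pℤ_p ≃ 𝔽_p` is finite** (Mathlib `PadicInt.toZMod`, kernel `(p)`). [folklore] -/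
private theorem finite_padicInt_quotient_p (p : ℕ) [Fact p.Prime] :
    Finite (ℤ_[p] ⧸ Ideal.span {(p : ℤ_[p])}) := by
  have hker : Ideal.span {(p : ℤ_[p])} = RingHom.ker (PadicInt.toZMod : ℤ_[p] →+* ZMod p) := by
    rw [PadicInt.ker_toZMod, PadicInt.maximalIdeal_eq_span_p]
  exact Finite.of_equiv (ZMod p) ((Ideal.quotEquivOfEq hker).trans
    (RingHom.quotientKerEquivOfSurjective (ZMod.ringHom_surjective PadicInt.toZMod))).symm.toEquiv

end Quotient

/-! ### §3. The `p`-adic coefficient pair `(padicCoeffIntegers ι, padicCoeffField ι)` -/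

section Padic

open scoped MatrixGroups ModularForm
open CongruenceSubgroup Literature.NumberTheory.EllipticCurves.ModularForms

variable {Γ : Subgroup (GL (Fin 2) ℝ)} {k : ℤ} {g : CuspForm Γ k} {p : ℕ} [Fact p.Prime]
  (ι : coeffField g →+* PadicAlgCl p)

/-- `‖p‖ = p⁻¹` in `ℚ̄_p` (Mathlib `PadicAlgCl.valuation_p`). [folklore] -/
private theorem norm_natCast_p : ‖(p : PadicAlgCl p)‖ = (p : ℝ)⁻¹ := by
  have h := PadicAlgCl.valuation_p p
  rw [PadicAlgCl.valuation_def] at h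
  have : (‖(p : PadicAlgCl p)‖₊ : ℝ) = ((1 / (p : NNReal) : NNReal) : ℝ) := by rw [h]
  simpa using this

/-- **Every `x ∈ K = ℚ_p(ι K_g)` has `p^j x ∈ 𝒪` for some `j`** (`K = 𝒪[1/p]`; take `p^j > ‖x‖`).
[cite: EmertonPollackWeston2006, §3.1 (p. 17, "`𝒪` the ring of integers of `K`")] -/
theorem exists_pow_p_mul_mem_padicCoeffIntegers (x : padicCoeffField ι) :
    ∃ (j : ℕ) (y : padicCoeffIntegers ι),
      algebraMap (padicCoeffIntegers ι) (padicCoeffField ι) y = (p : padicCoeffField ι) ^ j * x := by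
  have hp0 : (0 : ℝ) < p := by exact_mod_cast (Fact.out : p.Prime).pos
  have hp1 : (1 : ℝ) < p := by exact_mod_cast (Fact.out : p.Prime).one_lt
  obtain ⟨j, hj⟩ := pow_unbounded_of_one_lt ‖(x : PadicAlgCl p)‖ hp1
  have hy : (p : padicCoeffField ι) ^ j * x ∈ padicCoeffIntegers ι := by
    rw [mem_padicCoeffIntegers_iff]
    push_cast
    rw [norm_mul, norm_pow, norm_natCast_p, inv_pow, inv_mul_le_iff₀ (pow_pos hp0 j), mul_one]
    exact hj.le
  exact ⟨j, ⟨_, hy⟩, rfl⟩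

variable [FiniteDimensional ℚ_[p] (padicCoeffField ι)]

/-- **`𝒪/p𝒪` is finite** for `𝒪 = padicCoeffIntegers ι` (`K/ℚ_p` finite: `𝒪` is a finitely generated
`ℤ_p`-module, `GreenbergSelmer.moduleFinite_padicCoeffIntegers`, and `ℤ_p/p` is finite).
[cite: NeukirchANT1999, Ch. II (6.8) with (4.8)] -/
theorem finite_padicCoeffIntegers_quotient_p :
    Finite (padicCoeffIntegers ι ⧸ Ideal.span {(p : padicCoeffIntegers ι)}) := by
  haveI := moduleFinite_padicCoeffIntegers ι
  haveI := finite_padicInt_quotient_p p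
  have h := finite_quotient_span_algebraMap (R := ℤ_[p]) (𝒪 := padicCoeffIntegers ι) (p : ℤ_[p])
  rwa [map_natCast] at h

variable {G : Type*} [Group G] [TopologicalSpace G] {n : ℕ} (ρ : FramedRep G (padicCoeffIntegers ι) n)

/-- **`A_g[p]` is finite** for the cofree module `A_g = Kⁿ/𝒪ⁿ` of a framed `ρ : G → GL_n(𝒪)`,
`𝒪 = padicCoeffIntegers ι` (the hypothesis `hfin` of `SkinnerUrban2014.moduleFinite_XBig_of_lemma319` for the
members `g_m`). [cite: Greenberg1989, §1 p. 98] [cite: SkinnerUrban2014, Lemma 3.1.9 (hypothesis "M finitely generated")] -/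
theorem Cofree.finite_setOf_psmul_eq_zero :
    {a : Cofree ρ (padicCoeffField ι) | p • a = 0}.Finite := by
  haveI := finite_padicCoeffIntegers_quotient_p ι
  exact Cofree.finite_setOf_nsmul_eq_zero ρ p (Nat.cast_ne_zero.2 (Fact.out : p.Prime).ne_zero)

omit [FiniteDimensional ℚ_[p] (padicCoeffField ι)] in
/-- **`A_g` is `p`-primary** for `A_g = Kⁿ/𝒪ⁿ`, `𝒪 = padicCoeffIntegers ι` (the hypothesis `hprim` of
`SkinnerUrban2014.moduleFinite_XBig_of_lemma319` for the members `g_m`). [cite: Greenberg1989, §1 p. 98] -/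
theorem Cofree.exists_pow_psmul_eq_zero (a : Cofree ρ (padicCoeffField ι)) : ∃ j : ℕ, p ^ j • a = 0 :=
  Cofree.exists_pow_nsmul_eq_zero ρ p (exists_pow_p_mul_mem_padicCoeffIntegers ι) a

end Padic

end Literature.NumberTheory.EllipticCurves.GreenbergSelmer
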